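import Summits.QuantumFields.YangMills.Theorems.AlphaInputsT3ACv3EMLTwoFieldIterUniform
import Literature.Analysis.Complex.RungeBoxes
import HarnessLib

/-!
# `AlphaInputsT3ACv3FLExpUpdate` — STRATEGY B for 2′, non-abelian (FL) (memo v2.1 row R6, the UPDATE): **THE EXPONENTIAL UPDATE `U′ = e^{a}·U` OF A FINE FIELD BY A SUP-SMALL
# `su(N)`-VALUED ONE-FORM** — its size (`‖U′_b − U_b‖ ≤ 2α`), its linear part (`‖(U′_b − U_b) − a_b‖ ≤ αδ + α²`), the `k`-fold response
# `‖V(c) − Ū′^{(k)}(c)‖ ≤ τ₀ + 2|n|²(d+1)L^k(αδ + α²) + e_k(2α)` when `Q^{(k)}a` is the defect up to `τ₀` (w2 g2's `liftS` ∕ w3's matrix port: EXACT, `τ₀` = frame error only)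
# — lane `pub-balaban3d` ∕ cell `ym3-torus`, seat `ym-ust-19936-w1` (g0)

WHY (HOME `ym-ust-19936-w1/NONABELIAN-FL-NEWTON-w1-g0.md` §2 R6, §6; ★w2 g2 PROGRESS 1 01:09Z: `LinearLiftSpread.liftS` is EXACT (`linAvgIter_liftS`) AND sup-small (`abs_liftS_le`,
`18^d(2+(d+1)18^d)·M/L^k`), so the contraction's update needs NO block-constant gauge rotation: `ψ = 0` in `…v3FLContractionCore`).  With `a :=` the matrix port of `liftS` applied to the
stencil-gauge defect `Δ = V − Ū^{(k)}` (w3's (V)), this file turns the derivative row (`…v3EMLTwoFieldIterUniform`) into the DEFECT and PLAQUETTE recursions of one contraction step: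
new defect `≤ τ₀ + 2|n|²(d+1)·(L^kα)·(δ + α) + 5200L(d+2)²·m_k(2α)(m_k(2α) + m_k(δ))` — every term `O(|Δ|·(L^kδ + |Δ|))` since `L^kα = O(18^{2d}|Δ|)`.  No `k` in any
constant.  (The plaquette bookkeeping of the update — `U′(∂q) − U(∂q) = curl a + O(α(α+δ))` — is the sequel file.)
WHAT IS HERE (no definition; `Q` characterised as before): §1 `iterLin_sub` (the composites are additive), exp facts; §2 `norm_expUpdate_sub_le`, `norm_expUpdate_sub_sub_le`; §3 ★★
`norm_defect_after_expUpdate_le`.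
HONEST FRAMING.  Stencil gauge (all fields near `1` bondwise); the lift itself (w3), the glued start (R9′), the global assembly and the limit are NOT here; `hLift`∕(FL) NOT proved; count-neutral
helper toward R3 2′ (items 19936∕19935); registry untouched; nothing about d = 4, the continuum, or a mass gap; YM₃ on T³ is rung R3, not Clay.

References: T. Bałaban, Commun. Math. Phys. 98 (1985) 17–51 [Balaban1985Averaging] ((9) p.19, (24) p.21, Prop. 4 (134)–(135) p.38); CMP 102 (1985) 277–309 [Balaban1985Variational]
((15)–(17) p.280); CMP 109 (1987) 249–301 [Balaban1987RG1] ((0.4) p.253).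
-/

set_option autoImplicit false

noncomputable section

namespace Summit.QuantumFields.YangMills.Theorems.FLContraction

open Finset NormedSpace
open scoped Matrix.Norms.L2Operator
open Literature.MathematicalPhysics.QuantumFieldTheory.Balaban1983to89
open T4Continuum AveragingRT BlockAveraging ExpMeanLog BlockAveragingEMLLinearised
open Summit.QuantumFields.YangMills.Theorems.Prop7AvgLinearisation (linAvg_sub)
open Summit.QuantumFields.YangMills.Theorems.LinearAvgMatrix (norm_iterLin_le)
open Summit.QuantumFields.YangMills.Theorems.EMLTwoField (norm_iter_sub_iter_sub_iterLin_le_uniform)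

variable {P : Params} {n : Type*} [Fintype n] [DecidableEq n] [Nonempty n]

/-! ## §1 Additivity of the composites; exponential facts -/

omit [Fintype n] [DecidableEq n] [Nonempty n] in
/-- The characterised composites of `linAvg` are additive: `Q s (Y − Y′) = Q s Y − Q s Y′`. [cite: Balaban1987RG1, (0.11) p.253] -/
theorem iterLin_sub (Q : (i : ℕ) → (PBond P 0 → Matrix n n ℂ) → PBond P i → Matrix n n ℂ)
    (hQ0 : ∀ Y, Q 0 Y = Y) (hQs : ∀ (i : ℕ) (Y : PBond P 0 → Matrix n n ℂ) (c : PBond P (i + 1)), Q (i + 1) Y c = linAvg (Q i Y) c)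
    (Y Y' : PBond P 0 → Matrix n n ℂ) : ∀ (s : ℕ) (c : PBond P s), Q s (fun b => Y b - Y' b) c = Q s Y c - Q s Y' c
  | 0, c => by rw [hQ0, hQ0, hQ0]
  | s + 1, c => by
    rw [hQs, hQs, hQs, ← linAvg_sub]
    congr 1
    funext b
    exact iterLin_sub Q hQ0 hQs Y Y' s b

omit [Nonempty n] in
/-- `‖e^{a} − 1‖ ≤ 2‖a‖` and `‖e^{a} − 1 − a‖ ≤ ‖a‖²` for `‖a‖ ≤ 1` (matrices, `L²`-operator norm). [cite: Balaban1985Averaging, (24) p.21] -/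
theorem norm_exp_sub_one_le_two_mul' (a : Matrix n n ℂ) (ha : ‖a‖ ≤ 1) : ‖exp a - 1 - a‖ ≤ ‖a‖ ^ 2 ∧ ‖exp a - 1‖ ≤ 2 * ‖a‖ := by
  have h2 : ‖exp a - 1 - a‖ ≤ ‖a‖ ^ 2 := Literature.Analysis.Complex.norm_exp_sub_one_sub_le ha
  refine ⟨h2, ?_⟩
  have e : exp a - 1 = (exp a - 1 - a) + a := by abel
  rw [e]
  refine (norm_add_le _ _).trans ?_
  nlinarith [norm_nonneg a]

/-! ## §2 The exponential update, bond by bond -/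

/-- **SIZE AND LINEAR PART OF THE UPDATE**: for `U′_b = e^{a_b}U_b` with `‖a_b‖ ≤ α ≤ 1`, `‖U_b − 1‖ ≤ δ`:  `‖U′_b − U_b‖ ≤ 2α` and `‖(U′_b − U_b) − a_b‖ ≤ αδ + α²`
(`U′ − U − a = a(U − 1) + (e^{a} − 1 − a)U`, `‖U‖ = 1`). [cite: Balaban1985Variational, (15) p.280] -/
theorem norm_expUpdate_sub_le (U U' : GaugeField P 0 (Matrix.specialUnitaryGroup n ℂ)) (a : PBond P 0 → Matrix n n ℂ) {α δ : ℝ} (hα1 : α ≤ 1)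
    (hU' : ∀ b, ((U' b : Matrix.specialUnitaryGroup n ℂ) : Matrix n n ℂ) = exp (a b) * ((U b : Matrix.specialUnitaryGroup n ℂ) : Matrix n n ℂ))
    (ha : ∀ b, ‖a b‖ ≤ α) (hU : ∀ b, ‖((U b : Matrix.specialUnitaryGroup n ℂ) : Matrix n n ℂ) - 1‖ ≤ δ) (b : PBond P 0) :
    ‖((U' b : Matrix.specialUnitaryGroup n ℂ) : Matrix n n ℂ) - ((U b : Matrix.specialUnitaryGroup n ℂ) : Matrix n n ℂ)‖ ≤ 2 * α ∧
    ‖((U' b : Matrix.specialUnitaryGroup n ℂ) : Matrix n n ℂ) - ((U b : Matrix.specialUnitaryGroup n ℂ) : Matrix n n ℂ) - a b‖ ≤ α * δ + α ^ 2 := by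
  have hα0 : 0 ≤ α := (norm_nonneg _).trans (ha b)
  have hu1 : ‖((U b : Matrix.specialUnitaryGroup n ℂ) : Matrix n n ℂ)‖ = 1 :=
    CStarRing.norm_of_mem_unitary (Matrix.mem_specialUnitaryGroup_iff.1 (U b).2).1
  obtain ⟨h2, h1⟩ := norm_exp_sub_one_le_two_mul' (a b) ((ha b).trans hα1)
  set u : Matrix n n ℂ := ((U b : Matrix.specialUnitaryGroup n ℂ) : Matrix n n ℂ)
  rw [hU']
  refine ⟨?_, ?_⟩
  · have e : exp (a b) * u - u = (exp (a b) - 1) * u := by noncomm_ring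
    rw [e]
    calc _ ≤ ‖exp (a b) - 1‖ * ‖u‖ := norm_mul_le _ _
      _ ≤ 2 * ‖a b‖ * 1 := by rw [hu1]; exact mul_le_mul_of_nonneg_right h1 zero_le_one
      _ ≤ 2 * α := by linarith [ha b]
  · have e : exp (a b) * u - u - a b = a b * (u - 1) + (exp (a b) - 1 - a b) * u := by noncomm_ring
    rw [e]
    calc _ ≤ ‖a b‖ * ‖u - 1‖ + ‖exp (a b) - 1 - a b‖ * ‖u‖ := (norm_add_le _ _).trans (add_le_add (norm_mul_le _ _) (norm_mul_le _ _))
      _ ≤ α * δ + ‖a b‖ ^ 2 * 1 := by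
          rw [hu1]
          exact add_le_add (mul_le_mul (ha b) (hU b) (norm_nonneg _) hα0) (mul_le_mul_of_nonneg_right h2 zero_le_one)
      _ ≤ α * δ + α ^ 2 := by nlinarith [norm_nonneg (a b), ha b]

/-! ## §3 The defect after the exponential update -/

/-- **★★ THE DEFECT AFTER THE EXPONENTIAL UPDATE** (stencil gauge; `Q` the characterised composites; `d + 2 ≤ L`).  Let `U` be `δ`-close to `1`, `U′_b = e^{a_b}U_b` with `‖a_b‖ ≤ α ≤ 1`, and
let `Q^{(k)}a` reproduce the defect on `S` up to `τ₀`: `‖Q^{(k)}a(c) − (V(c) − Ū^{(k)}(c))‖ ≤ τ₀` (EXACT lifts: `τ₀` = frame∕restriction error only).  Under the smallness of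
`…v3EMLTwoFieldIterUniform` at `ρ := 2α`:  `‖V(c) − Ū′^{(k)}(c)‖ ≤ τ₀ + 2|n|²(d+1)L^k·(αδ + α²) + 5200·L·(d+2)²·m_k(2α)·(m_k(2α) + m_k(δ))` on `S` — with `L^kα = O(|Δ|)`, `L^kδ = O(ε)`
this is `|Δ′| ≤ poly·|Δ|·(ε + |Δ|)`, NO `k` in the constant. [cite: Balaban1985Averaging, Prop. 4 (134)–(135) p.38; Balaban1985Variational, (15)–(17) p.280] -/
theorem norm_defect_after_expUpdate_le
    (Q : (i : ℕ) → (PBond P 0 → Matrix n n ℂ) → PBond P i → Matrix n n ℂ)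
    (hQ0 : ∀ Y, Q 0 Y = Y) (hQs : ∀ (i : ℕ) (Y : PBond P 0 → Matrix n n ℂ) (c : PBond P (i + 1)), Q (i + 1) Y c = linAvg (Q i Y) c)
    (hL : P.d + 2 ≤ P.L) (k : ℕ) (U U' : GaugeField P 0 (Matrix.specialUnitaryGroup n ℂ)) (a : PBond P 0 → Matrix n n ℂ) {α δ : ℝ} (hδ : 0 ≤ δ) (hα1 : α ≤ 1)
    (hU' : ∀ b, ((U' b : Matrix.specialUnitaryGroup n ℂ) : Matrix n n ℂ) = exp (a b) * ((U b : Matrix.specialUnitaryGroup n ℂ) : Matrix n n ℂ))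
    (ha : ∀ b, ‖a b‖ ≤ α) (hU : ∀ b, ‖((U b : Matrix.specialUnitaryGroup n ℂ) : Matrix n n ℂ) - 1‖ ≤ δ)
    (hmδ : 324 * (P.L : ℝ) * ((P.d : ℝ) + 2) ^ 2 * (2 * (Fintype.card n : ℝ) ^ 2 * (((P.d : ℝ) + 1) * (P.L : ℝ) ^ k * δ)) ≤ 1)
    (hm : 5200 * (P.L : ℝ) * ((P.d : ℝ) + 2) ^ 2 *
      (2 * (Fintype.card n : ℝ) ^ 2 * (((P.d : ℝ) + 1) * (P.L : ℝ) ^ k * (2 * α)) + 2 * (Fintype.card n : ℝ) ^ 2 * (((P.d : ℝ) + 1) * (P.L : ℝ) ^ k * δ)) ≤ 1)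
    (hN : 4 * (((P.d + 2) * P.L : ℕ) : ℝ) *
      (2 * (Fintype.card n : ℝ) ^ 2 * (((P.d : ℝ) + 1) * (P.L : ℝ) ^ k * (2 * α)) + 2 * (Fintype.card n : ℝ) ^ 2 * (((P.d : ℝ) + 1) * (P.L : ℝ) ^ k * δ)) < deltaSU n)
    (V : GaugeField P k (Matrix.specialUnitaryGroup n ℂ)) (S : Set (PBond P k)) {τ₀ : ℝ}
    (hQa : ∀ c ∈ S, ‖Q k a c - (((V c : Matrix.specialUnitaryGroup n ℂ) : Matrix n n ℂ) -
        ((Averaging.iter (fun i => blockAvg (P := P) (j := i) (expMeanLogSU (n := n))) k U c : Matrix.specialUnitaryGroup n ℂ) : Matrix n n ℂ))‖ ≤ τ₀) :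
    ∀ c ∈ S, ‖((V c : Matrix.specialUnitaryGroup n ℂ) : Matrix n n ℂ) -
        ((Averaging.iter (fun i => blockAvg (P := P) (j := i) (expMeanLogSU (n := n))) k U' c : Matrix.specialUnitaryGroup n ℂ) : Matrix n n ℂ)‖ ≤
      τ₀ + 2 * (Fintype.card n : ℝ) ^ 2 * (((P.d : ℝ) + 1) * (P.L : ℝ) ^ k * (α * δ + α ^ 2)) +
        5200 * (P.L : ℝ) * ((P.d : ℝ) + 2) ^ 2 * ((2 * (Fintype.card n : ℝ) ^ 2 * (((P.d : ℝ) + 1) * (P.L : ℝ) ^ k * (2 * α))) *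
          ((2 * (Fintype.card n : ℝ) ^ 2 * (((P.d : ℝ) + 1) * (P.L : ℝ) ^ k * (2 * α))) + (2 * (Fintype.card n : ℝ) ^ 2 * (((P.d : ℝ) + 1) * (P.L : ℝ) ^ k * δ)))) := by
  intro c hc
  have hα0 : 0 ≤ α := (norm_nonneg _).trans (ha ⟨fun _ => 0, c.dir⟩)
  set Z : PBond P 0 → Matrix n n ℂ := fun b => ((U' b : Matrix.specialUnitaryGroup n ℂ) : Matrix n n ℂ) - ((U b : Matrix.specialUnitaryGroup n ℂ) : Matrix n n ℂ) with hZ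
  have hρ : ∀ b, ‖Z b‖ ≤ 2 * α := fun b => (norm_expUpdate_sub_le U U' a hα1 hU' ha hU b).1
  have hZa : ∀ b, ‖Z b - a b‖ ≤ α * δ + α ^ 2 := fun b => (norm_expUpdate_sub_le U U' a hα1 hU' ha hU b).2
  -- the derivative row at `(U′, U)`
  have hderiv := (norm_iter_sub_iter_sub_iterLin_le_uniform Q hQ0 hQs hL U' U hδ (by positivity) hU hρ k hmδ hm hN k le_rfl c).2
  -- `Q k Z − Q k a = Q k (Z − a)`, bounded on the natural scale
  have hlin : ‖Q k Z c - Q k a c‖ ≤ 2 * (Fintype.card n : ℝ) ^ 2 * (((P.d : ℝ) + 1) * (P.L : ℝ) ^ k * (α * δ + α ^ 2)) := by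
    rw [← iterLin_sub Q hQ0 hQs]
    exact norm_iterLin_le Q hQ0 hQs _ hZa k c
  set Φ : Matrix n n ℂ := ((Averaging.iter (fun i => blockAvg (P := P) (j := i) (expMeanLogSU (n := n))) k U c : Matrix.specialUnitaryGroup n ℂ) : Matrix n n ℂ)
  set Φ' : Matrix n n ℂ := ((Averaging.iter (fun i => blockAvg (P := P) (j := i) (expMeanLogSU (n := n))) k U' c : Matrix.specialUnitaryGroup n ℂ) : Matrix n n ℂ)
  set Vc : Matrix n n ℂ := ((V c : Matrix.specialUnitaryGroup n ℂ) : Matrix n n ℂ)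
  have e : Vc - Φ' = -(Q k a c - (Vc - Φ)) - (Q k Z c - Q k a c) - (Φ' - Φ - Q k Z c) := by abel
  rw [e]
  calc ‖-(Q k a c - (Vc - Φ)) - (Q k Z c - Q k a c) - (Φ' - Φ - Q k Z c)‖
      ≤ ‖-(Q k a c - (Vc - Φ))‖ + ‖Q k Z c - Q k a c‖ + ‖Φ' - Φ - Q k Z c‖ := (norm_sub_le _ _).trans (add_le_add (norm_sub_le _ _) le_rfl)
    _ ≤ _ := by rw [norm_neg]; exact add_le_add (add_le_add (hQa c hc) hlin) hderiv

end Summit.QuantumFields.YangMills.Theorems.FLContraction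

end
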